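import Mathlib
import HarnessLib
import Summits.NavierStokesRegularity.NavierStokesRegularity.Theorems.TaylorModelRungThreeSoundnessVectorPair

/-!
# Line `taylor-model` on crux K1b-DR (`ExactWindowRungThree.DerivativeEnclosureCertificateR`,
# stmt-NavierStokesRegularity-23954) — VECTOR STEP LEMMA, part 11: uniqueness of the variation and the variational
# Taylor model along the selector

Two conveniences for the consumers of parts 3/4/9/10 (all of which produce "a" variational solution `V`):

* `variational_unique` — along a bounded trajectory `ψ`, two solutions of `V' = Q(ψ,V) + Q(V,ψ)` on `[0,t]` with the
  same initial value coincide (Grönwall with `δ = ε = 0`), so the `V` of the derivative theorems and the `V` of the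
  remainder theorems are the same object;
* `flowSel_var_of_roughEnclosure` — `Fin n` / S1 vocabulary: under the first-order tests (E1) (state box) and (V1)
  (variation box) there is a variational solution `V` from `v₀` along `flowSel Q x₀`, confined to `[loV,hiV]`, with the
  componentwise remainder `|V s c − Σ_{k≤p} U x₀ v₀ k c s^k| ≤ JV c · s^(p+1)` from an order-`p+1` enclosure `JV` of the
  variational jets over the product box (the `Vap`-clause supplier; `p` here is the variational order `p_v`).

MODEL-lattice bookkeeping only (rung TL-M3 of the NS ladder: one finite-dimensional model ODE); nothing
here is a statement about the Navier–Stokes equations.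
-/

noncomputable section

-- the sub-problem namespace repeats the summit name by design (D-0017)
set_option linter.dupNamespace false

namespace Summit.NavierStokesRegularity.NavierStokesRegularity.Theorems.TaylorModelVector

open scoped BigOperators Topology
open Set Filter Metric

section General

variable {ι : Type*} [Fintype ι] [DecidableEq ι]
  (Q : (ι → ℝ) →ₗ[ℝ] (ι → ℝ) →ₗ[ℝ] ι → ℝ)

/-- **Uniqueness of the variation**: along a trajectory `ψ` bounded by `R` on `[0,t]`, two solutions of the
variational equation with the same initial value agree on `[0,t]`. [folklore] -/
theorem variational_unique {ψ V W : ℝ → ι → ℝ} {t R : ℝ} (hR : ∀ s ∈ Icc 0 t, ‖ψ s‖ ≤ R)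
    (hV : ∀ s ∈ Icc 0 t, HasDerivWithinAt V (Q (ψ s) (V s) + Q (V s) (ψ s)) (Icc 0 t) s)
    (hW : ∀ s ∈ Icc 0 t, HasDerivWithinAt W (Q (ψ s) (W s) + Q (W s) (ψ s)) (Icc 0 t) s)
    (h0 : V 0 = W 0) : EqOn V W (Icc 0 t) := by
  obtain ⟨C, hC0, hC⟩ := exists_norm_Q_le Q
  intro s hs
  have hR0 : 0 ≤ R := (norm_nonneg _).trans (hR 0 ⟨le_rfl, hs.1.trans hs.2⟩)
  have hnhds : ∀ σ ∈ Ico (0:ℝ) t, Icc 0 t ∈ 𝓝[≥] σ := fun σ hσ =>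
    mem_of_superset (Icc_mem_nhdsGE hσ.2) (Icc_subset_Icc_left hσ.1)
  have hcont : ContinuousOn (fun σ => V σ - W σ) (Icc 0 t) := fun σ hσ =>
    ((hV σ hσ).sub (hW σ hσ)).continuousWithinAt
  have hder : ∀ σ ∈ Ico 0 t, HasDerivWithinAt (fun σ => V σ - W σ)
      (Q (ψ σ) (V σ) + Q (V σ) (ψ σ) - (Q (ψ σ) (W σ) + Q (W σ) (ψ σ))) (Ici σ) σ := fun σ hσ =>
    ((hV σ (Ico_subset_Icc_self hσ)).sub (hW σ (Ico_subset_Icc_self hσ))).mono_of_mem_nhdsWithin (hnhds σ hσ)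
  have hini : ‖V 0 - W 0‖ ≤ 0 := by rw [h0, sub_self, norm_zero]
  have hbound : ∀ σ ∈ Ico 0 t, ‖Q (ψ σ) (V σ) + Q (V σ) (ψ σ) - (Q (ψ σ) (W σ) + Q (W σ) (ψ σ))‖
      ≤ 2 * C * R * ‖V σ - W σ‖ + 0 := by
    intro σ hσ
    have e : Q (ψ σ) (V σ) + Q (V σ) (ψ σ) - (Q (ψ σ) (W σ) + Q (W σ) (ψ σ))
        = Q (ψ σ) (V σ - W σ) + Q (V σ - W σ) (ψ σ) := by
      rw [map_sub, map_sub, LinearMap.sub_apply]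
      abel
    rw [e, add_zero]
    have na : ‖ψ σ‖ ≤ R := hR σ (Ico_subset_Icc_self hσ)
    calc ‖Q (ψ σ) (V σ - W σ) + Q (V σ - W σ) (ψ σ)‖
        ≤ ‖Q (ψ σ) (V σ - W σ)‖ + ‖Q (V σ - W σ) (ψ σ)‖ := norm_add_le _ _
      _ ≤ C * ‖ψ σ‖ * ‖V σ - W σ‖ + C * ‖V σ - W σ‖ * ‖ψ σ‖ := add_le_add (hC _ _) (hC _ _)
      _ ≤ C * R * ‖V σ - W σ‖ + C * ‖V σ - W σ‖ * R := by gcongr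
      _ = 2 * C * R * ‖V σ - W σ‖ := by ring
  have G := norm_le_gronwallBound_of_norm_deriv_right_le hcont hder hini hbound s hs
  rw [gronwallBound_ε0_δ0] at G
  exact sub_eq_zero.1 (norm_le_zero_iff.1 G)

end General

/-! ### `Fin n` corollary: the variational Taylor model along the selector -/

section Majorant

open Summit.NavierStokesRegularity.NavierStokesRegularity.Theorems.TaylorModelMajorant

variable {n : ℕ} {Q : (Fin n → ℝ) → (Fin n → ℝ) → Fin n → ℝ} {w : Fin n → ℝ} {b : ℝ}
  {T : (Fin n → ℝ) → ℕ → Fin n → ℝ} {U : (Fin n → ℝ) → (Fin n → ℝ) → ℕ → Fin n → ℝ}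

/-- **The variation along the selector: existence, confinement, componentwise remainder** (no `b·m·h < 1`): under
the first-order tests for the state box `[lo,hi]` and the variation box `[loV,hiV]`, and an order-`p+1` enclosure
`|U y v (p+1) c| ≤ JV c` over the product box, there is `V` with `V 0 = v₀`, `V' = Q(flowSel Q x₀ s, V) + Q(V, …)` on
`[0,h]`, `V s ∈ [loV,hiV]`, and `|V s c − Σ_{k≤p} U x₀ v₀ k c s^k| ≤ JV c · s^(p+1)`. [folklore] -/
theorem flowSel_var_of_roughEnclosure (hS : IsMajorantSystem n Q w b T U)
    {lo hi x₀ loV hiV v₀ : Fin n → ℝ} {h : ℝ} (hx₀ : x₀ ∈ Icc lo hi) (hv₀ : v₀ ∈ Icc loV hiV) (hh : 0 ≤ h)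
    (henc : ∀ y ∈ Icc lo hi, ∀ u ∈ Icc (0:ℝ) h, x₀ + u • Q y y ∈ Icc lo hi)
    (hencV : ∀ y ∈ Icc lo hi, ∀ v ∈ Icc loV hiV, ∀ u ∈ Icc (0:ℝ) h,
      v₀ + u • (Q y v + Q v y) ∈ Icc loV hiV)
    {p : ℕ} {JV : Fin n → ℝ} (hJV : ∀ y ∈ Icc lo hi, ∀ v ∈ Icc loV hiV, ∀ c, |U y v (p + 1) c| ≤ JV c) :
    ∃ V : ℝ → Fin n → ℝ, V 0 = v₀ ∧
      (∀ s ∈ Icc 0 h, HasDerivWithinAt V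
        (Q (flowSel Q x₀ s) (V s) + Q (V s) (flowSel Q x₀ s)) (Icc 0 h) s) ∧
      (∀ s ∈ Icc 0 h, V s ∈ Icc loV hiV) ∧
      ∀ s ∈ Icc 0 h, ∀ c,
        |V s c - ∑ k ∈ Finset.range (p + 1), U x₀ v₀ k c * s ^ k| ≤ JV c * s ^ (p + 1) := by
  obtain ⟨Qb, hQb⟩ := exists_bundle hS
  have hTs : ∀ x (k : ℕ) c, ((k : ℝ) + 1) * T x (k + 1) c =
      ∑ i ∈ Finset.range (k + 1), Qb (T x i) (T x (k - i)) c := by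
    simpa only [hQb] using hS.T_succ
  have hUs : ∀ x v (k : ℕ) c, ((k : ℝ) + 1) * U x v (k + 1) c =
      ∑ i ∈ Finset.range (k + 1), (Qb (T x i) (U x v (k - i)) c + Qb (U x v (k - i)) (T x i) c) := by
    simpa only [hQb] using hS.U_succ
  have henc' : ∀ y ∈ Icc lo hi, ∀ u ∈ Icc (0:ℝ) h, x₀ + u • Qb y y ∈ Icc lo hi := by
    simpa only [hQb] using henc
  have hencV' : ∀ y ∈ Icc lo hi, ∀ v ∈ Icc loV hiV, ∀ u ∈ Icc (0:ℝ) h,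
      v₀ + u • (Qb y v + Qb v y) ∈ Icc loV hiV := by
    simpa only [hQb] using hencV
  obtain ⟨ψ, V, hψ0, hV0, hψder, hVder, hψbox, hVbox⟩ :=
    exists_pair_sol_mem_Icc_of_roughEnclosure Qb hx₀ hv₀ hh henc' hencV'
  have hsol : IsSolOn Q x₀ h ψ := ⟨hψ0, by simpa only [hQb] using hψder⟩
  have heq : ∀ s ∈ Icc 0 h, flowSel Q x₀ s = ψ s := fun s hs => hS.flowSel_eq hsol hs
  refine ⟨V, hV0, fun s hs => ?_, hVbox, fun s hs c => ?_⟩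
  · rw [heq s hs]
    simpa only [hQb] using hVder s hs
  · have key := abs_sub_varTaylor_le_of_mem_Icc Qb hS.T_zero hTs hS.U_zero hUs hψder hVder hψbox hVbox
      hJV s hs c
    rwa [hψ0, hV0] at key

end Majorant

end Summit.NavierStokesRegularity.NavierStokesRegularity.Theorems.TaylorModelVector

end
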